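import Literature.MathematicalPhysics.QuantumManyBody.FoldyMomentumIntegral
import Mathlib.MeasureTheory.Integral.DominatedConvergence
import Mathlib.Analysis.SpecialFunctions.ImproperIntegrals
import HarnessLib

/-!
# Removing the cutoffs in the Bogoliubov–Foldy integral (Lieb–Solovej 2001, after (6.19))

Topic `Literature/MathematicalPhysics/QuantumManyBody` (groundwork for `JelliumBoseGas.foldyLaw`,
[LSSY2005, Thm. 10.1]; continuation of `FoldyMomentumIntegral.lean`). In the Lieb–Solovej lower
bound the Bogoliubov Hamiltonian of a box is bounded below by `-I n^{5/4}ℓ^{-3/4} - …`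
[LiebSolovej2001, Lemma 6.4, Cor. 6.5] with
`I = ½(2π)⁻³ ∫_{ℝ³} (f(k) - (f(k)² - g(k)²)^{1/2}) dk`, where
`g(k) = 4π(1/(k² + (n^{1/4}ℓ^{-3/4}R)⁻²) - 1/(k² + (n^{1/4}ℓ^{-3/4}r)⁻²))` carries the long and
short distance cutoffs `R, r` of the Coulomb potential and
`f(k) = g(k) + ½γ⁻¹(1 - C't)² |k|⁴/(|k|² + (n^{1/4}ℓ^{1/4}t³)⁻²)` the Neumann/low-momentum cutoff of
the kinetic energy; and [LiebSolovej2001, after (6.19)]: "if `n^{1/4}ℓ^{-3/4}R → ∞`,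
`n^{1/4}ℓ^{-3/4}r → 0`, `n^{1/4}ℓ^{1/4}t³ → ∞` and `t → 0` it follows by dominated convergence that
`I` converges to `½(2π)⁻³∫ 4π|k|⁻² + ½|k|² - ((4π|k|⁻² + ½|k|²)² - (4π|k|⁻²)²)^{1/2} dk`" — the
Foldy integral (`bogoliubov_momentum_integral`). This file proves that dominated-convergence
statement, in the tree's units (kinetic coefficient `→ 1`, Coulomb weight `κ = 4πqρ`), for the
four-parameter family

`F_{a,b,c,d}(k) = (g + h) - √((g + h)² - g²)`, `g = κ(1/(|k|² + a⁻²) - 1/(|k|² + b⁻²))`,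
`h = c|k|⁴/(|k|² + d⁻²)`, as `a → ∞`, `b → 0⁺`, `c → 1`, `d → ∞`:

**`∫_{ℝ³} F_{a,b,c,d} → ∫_{ℝ³} (|k|² + κ|k|⁻² - √(|k|⁴ + 2κ)) dk`**, hence
`½(2π)⁻³ ∫ F_{a,b,c,d} → foldyConstant · q^{5/4}ρ^{5/4}` for `κ = 4πqρ`.

Domination (uniform for `a ≥ 1 ≥ b > 0`, `c ∈ [½, 2]`, `d ≥ 1`): `0 ≤ F ≤ min(g, g²/h)`,
`g ≤ κ/|k|²`, `h ≥ ½|k|⁴/(|k|² + 1)`, so `F ≤ min(κ|k|⁻², 2κ²(|k|² + 1)|k|⁻⁸) ∈ L¹(ℝ³)`.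

* `JelliumBoseGas.bogF_nonneg/le_left/le_sq_div` — `0 ≤ (g+h) - √((g+h)² - g²) ≤ min(g, g²/h)`.
* `JelliumBoseGas.integrable_foldyDominator` — the dominating function is integrable on `ℝ³`.
* `JelliumBoseGas.tendsto_foldyCutoffIntegrand` — pointwise convergence off the origin.
* `JelliumBoseGas.tendsto_integral_foldyCutoff` — **the dominated-convergence statement**;
  `JelliumBoseGas.tendsto_foldyCutoff_energy` — the corollary with `bogoliubov_momentum_integral`.

## References

* [LiebSolovej2001] E. H. Lieb, J. P. Solovej, Commun. Math. Phys. 217 (2001) 127–163, Lemma 6.4,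
  Cor. 6.5 and the display after (6.19) (arXiv:cond-mat/0007425, pp. 16–17).
* [LSSY2005] Thm. 10.1 (10.2).
-/

noncomputable section

open MeasureTheory Set Filter Real Metric Topology
open scoped ENNReal

namespace Literature.MathematicalPhysics.QuantumManyBody.JelliumBoseGas

open BoseGas

/-! ### The Bogoliubov function `(g + h) - √((g + h)² - g²)` -/

/-- `0 ≤ (g + h) - √((g + h)² - g²)` for `g, h ≥ 0`. [cite: LiebSolovej2001, Thm. 6.3] -/
theorem bogF_nonneg {g h : ℝ} (hg : 0 ≤ g) (hh : 0 ≤ h) :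
    0 ≤ (g + h) - Real.sqrt ((g + h) ^ 2 - g ^ 2) := by
  have : Real.sqrt ((g + h) ^ 2 - g ^ 2) ≤ g + h := by
    rw [Real.sqrt_le_left (by positivity)]
    nlinarith [sq_nonneg g]
  linarith

/-- `(g + h) - √((g + h)² - g²) ≤ g` for `g, h ≥ 0` (since `(g + h)² - g² ≥ h²`).
[cite: LiebSolovej2001, Cor. 6.5 (proof)] -/
theorem bogF_le_left {g h : ℝ} (hg : 0 ≤ g) (hh : 0 ≤ h) :
    (g + h) - Real.sqrt ((g + h) ^ 2 - g ^ 2) ≤ g := by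
  have : h ≤ Real.sqrt ((g + h) ^ 2 - g ^ 2) := by
    calc h = Real.sqrt (h ^ 2) := (Real.sqrt_sq hh).symm
      _ ≤ Real.sqrt ((g + h) ^ 2 - g ^ 2) := Real.sqrt_le_sqrt (by nlinarith [mul_nonneg hg hh])
  linarith

/-- `(g + h) - √((g + h)² - g²) ≤ g²/h` for `g ≥ 0`, `h > 0`
(`F · ((g + h) + √) = g²` and the denominator is `≥ h`). [cite: LiebSolovej2001, Cor. 6.5 (proof)] -/
theorem bogF_le_sq_div {g h : ℝ} (hg : 0 ≤ g) (hh : 0 < h) :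
    (g + h) - Real.sqrt ((g + h) ^ 2 - g ^ 2) ≤ g ^ 2 / h := by
  set s : ℝ := Real.sqrt ((g + h) ^ 2 - g ^ 2) with hs
  have hD : 0 ≤ (g + h) ^ 2 - g ^ 2 := by nlinarith [mul_nonneg hg hh.le]
  have hs0 : 0 ≤ s := Real.sqrt_nonneg _
  have hs2 : s ^ 2 = (g + h) ^ 2 - g ^ 2 := Real.sq_sqrt hD
  have hprod : ((g + h) - s) * ((g + h) + s) = g ^ 2 := by nlinarith
  have hden : h ≤ (g + h) + s := by linarith
  have hden0 : 0 < (g + h) + s := hh.trans_le hden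
  rw [le_div_iff₀ hh]
  have hF0 : 0 ≤ (g + h) - s := bogF_nonneg hg hh.le
  calc ((g + h) - s) * h ≤ ((g + h) - s) * ((g + h) + s) :=
        mul_le_mul_of_nonneg_left hden hF0
    _ = g ^ 2 := hprod

/-! ### The dominating function -/

/-- **Integrability of the dominator**: `k ↦ min(κ|k|⁻², 2κ²(|k|² + 1)|k|⁻⁸)` is integrable on
`ℝ³` (polar coordinates: `r² · min = min(κ, 2κ²(r²+1)r⁻⁶) ≤ κ` on `(0, 1]` and `≤ 4κ² r⁻⁴` on
`[1, ∞)`). [cite: LiebSolovej2001, Cor. 6.5 (proof)] -/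
theorem integrable_foldyDominator {κ : ℝ} (hκ : 0 ≤ κ) :
    Integrable fun k : Space => min (κ / ‖k‖ ^ 2) (2 * κ ^ 2 * (‖k‖ ^ 2 + 1) / ‖k‖ ^ 8) := by
  have h := (integrable_fun_norm_addHaar (volume : Measure Space)
    (f := fun r : ℝ => min (κ / r ^ 2) (2 * κ ^ 2 * (r ^ 2 + 1) / r ^ 8))).2
  refine h ?_
  rw [finrank_euclideanSpace_fin, show (3 : ℕ) - 1 = 2 from rfl]
  -- the radial function `r² • min(κ/r², 2κ²(r²+1)/r⁸)` on `(0, ∞)`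
  have hFm : Measurable (fun r : ℝ => r ^ 2 •
      min (κ / r ^ 2) (2 * κ ^ 2 * (r ^ 2 + 1) / r ^ 8)) := by
    refine (measurable_id.pow_const _).smul (Measurable.min ?_ ?_)
    · exact measurable_const.div (measurable_id.pow_const _)
    · exact (measurable_const.mul ((measurable_id.pow_const _).add_const _)).div
        (measurable_id.pow_const _)
  have hnn : ∀ r : ℝ, 0 < r → 0 ≤ r ^ 2 • min (κ / r ^ 2) (2 * κ ^ 2 * (r ^ 2 + 1) / r ^ 8) :=
    fun r hr => by
      rw [smul_eq_mul]
      exact mul_nonneg (by positivity) (le_min (by positivity) (by positivity))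
  -- on `(0, 1]`
  have h1 : IntegrableOn (fun r : ℝ => r ^ 2 •
      min (κ / r ^ 2) (2 * κ ^ 2 * (r ^ 2 + 1) / r ^ 8)) (Ioc 0 1) := by
    refine Integrable.mono' (g := fun _ => κ) (integrableOn_const measure_Ioc_lt_top.ne)
      hFm.aestronglyMeasurable ?_
    refine (ae_restrict_iff' measurableSet_Ioc).2 (Eventually.of_forall fun r hr => ?_)
    have hr0 : 0 < r := hr.1
    rw [Real.norm_of_nonneg (hnn r hr0), smul_eq_mul]
    calc r ^ 2 * min (κ / r ^ 2) (2 * κ ^ 2 * (r ^ 2 + 1) / r ^ 8)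
        ≤ r ^ 2 * (κ / r ^ 2) := mul_le_mul_of_nonneg_left (min_le_left _ _) (by positivity)
      _ = κ := by field_simp
  -- on `(1, ∞)`
  have h2 : IntegrableOn (fun r : ℝ => r ^ 2 •
      min (κ / r ^ 2) (2 * κ ^ 2 * (r ^ 2 + 1) / r ^ 8)) (Ioi 1) := by
    have hint : IntegrableOn (fun r : ℝ => 4 * κ ^ 2 * r ^ (-4 : ℝ)) (Ioi 1) :=
      ((integrableOn_Ioi_rpow_of_lt (by norm_num : (-4 : ℝ) < -1) zero_lt_one).const_mul _)
    refine Integrable.mono' hint hFm.aestronglyMeasurable ?_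
    refine (ae_restrict_iff' measurableSet_Ioi).2 (Eventually.of_forall fun r hr => ?_)
    have hr1 : (1 : ℝ) < r := hr
    have hr0 : 0 < r := zero_lt_one.trans hr1
    rw [Real.norm_of_nonneg (hnn r hr0), smul_eq_mul]
    have e4 : r ^ (-4 : ℝ) = (r ^ 4)⁻¹ := by
      rw [Real.rpow_neg hr0.le, show (4 : ℝ) = ((4 : ℕ) : ℝ) by norm_num, Real.rpow_natCast]
    calc r ^ 2 * min (κ / r ^ 2) (2 * κ ^ 2 * (r ^ 2 + 1) / r ^ 8)
        ≤ r ^ 2 * (2 * κ ^ 2 * (r ^ 2 + 1) / r ^ 8) :=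
          mul_le_mul_of_nonneg_left (min_le_right _ _) (by positivity)
      _ = 2 * κ ^ 2 * (r ^ 2 + 1) / r ^ 6 := by field_simp
      _ ≤ 2 * κ ^ 2 * (r ^ 2 + r ^ 2) / r ^ 6 := by gcongr; nlinarith
      _ = 4 * κ ^ 2 * r ^ (-4 : ℝ) := by
          rw [e4]
          field_simp
          ring
  have h12 := h1.union h2
  rw [Ioc_union_Ioi_eq_Ioi zero_le_one] at h12
  exact h12

/-! ### The cutoff integrand, its domination and its pointwise limit -/

/-- **Uniform domination of the cut-off Bogoliubov integrand**: for `a ≥ 1 ≥ b > 0`,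
`c ∈ [½, 2]`, `d ≥ 1`, `κ ≥ 0` and `k ≠ 0`, with `g = κ(1/(|k|²+a⁻²) - 1/(|k|²+b⁻²))`,
`h = c|k|⁴/(|k|² + d⁻²)`: `0 ≤ (g+h) - √((g+h)² - g²) ≤ min(κ|k|⁻², 2κ²(|k|²+1)|k|⁻⁸)`.
[cite: LiebSolovej2001, Cor. 6.5 (proof)] -/
theorem foldyCutoffIntegrand_bounds {κ a b c d : ℝ} (hκ : 0 ≤ κ) (ha : 1 ≤ a) (hb0 : 0 < b)
    (hb1 : b ≤ 1) (hc0 : 1 / 2 ≤ c) (hd : 1 ≤ d) {k : Space} (hk : k ≠ 0) :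
    let g := κ * (1 / (‖k‖ ^ 2 + a⁻¹ ^ 2) - 1 / (‖k‖ ^ 2 + b⁻¹ ^ 2))
    let h := c * ‖k‖ ^ 4 / (‖k‖ ^ 2 + d⁻¹ ^ 2)
    0 ≤ (g + h) - Real.sqrt ((g + h) ^ 2 - g ^ 2) ∧
      (g + h) - Real.sqrt ((g + h) ^ 2 - g ^ 2) ≤
        min (κ / ‖k‖ ^ 2) (2 * κ ^ 2 * (‖k‖ ^ 2 + 1) / ‖k‖ ^ 8) := by
  intro g h
  have hk0 : 0 < ‖k‖ := norm_pos_iff.2 hk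
  have hk2 : 0 < ‖k‖ ^ 2 := by positivity
  -- `0 ≤ g ≤ κ/|k|²`
  have hab : a⁻¹ ^ 2 ≤ b⁻¹ ^ 2 := by
    have h1 : a⁻¹ ≤ 1 := inv_le_one_of_one_le₀ ha
    have h2 : 1 ≤ b⁻¹ := one_le_inv₀ hb0 |>.2 hb1
    have h3 : 0 ≤ a⁻¹ := inv_nonneg.2 (zero_le_one.trans ha)
    nlinarith
  have hg0 : 0 ≤ g := by
    have : 1 / (‖k‖ ^ 2 + b⁻¹ ^ 2) ≤ 1 / (‖k‖ ^ 2 + a⁻¹ ^ 2) :=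
      one_div_le_one_div_of_le (by positivity) (by linarith)
    exact mul_nonneg hκ (by linarith)
  have hg1 : g ≤ κ / ‖k‖ ^ 2 := by
    have h1 : 1 / (‖k‖ ^ 2 + a⁻¹ ^ 2) ≤ 1 / ‖k‖ ^ 2 :=
      one_div_le_one_div_of_le hk2 (by nlinarith [sq_nonneg a⁻¹])
    have h2 : 0 ≤ 1 / (‖k‖ ^ 2 + b⁻¹ ^ 2) := by positivity
    calc g ≤ κ * (1 / ‖k‖ ^ 2) := mul_le_mul_of_nonneg_left (by linarith) hκ
      _ = κ / ‖k‖ ^ 2 := by ring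
  -- `h ≥ ½ |k|⁴/(|k|² + 1) > 0`
  have hd1 : d⁻¹ ^ 2 ≤ 1 := by
    have h1 : d⁻¹ ≤ 1 := inv_le_one_of_one_le₀ hd
    have h3 : 0 ≤ d⁻¹ := inv_nonneg.2 (zero_le_one.trans hd)
    nlinarith
  have hhpos : 0 < h := by positivity
  have hh1 : 1 / 2 * ‖k‖ ^ 4 / (‖k‖ ^ 2 + 1) ≤ h := by
    calc 1 / 2 * ‖k‖ ^ 4 / (‖k‖ ^ 2 + 1) ≤ c * ‖k‖ ^ 4 / (‖k‖ ^ 2 + 1) := by gcongr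
      _ ≤ c * ‖k‖ ^ 4 / (‖k‖ ^ 2 + d⁻¹ ^ 2) := by
          apply div_le_div_of_nonneg_left (by positivity) (by positivity)
          linarith
  refine ⟨bogF_nonneg hg0 hhpos.le, le_min ((bogF_le_left hg0 hhpos.le).trans hg1) ?_⟩
  -- `F ≤ g²/h ≤ (κ/|k|²)² (|k|²+1)/(½|k|⁴)`
  calc (g + h) - Real.sqrt ((g + h) ^ 2 - g ^ 2) ≤ g ^ 2 / h := bogF_le_sq_div hg0 hhpos
    _ ≤ (κ / ‖k‖ ^ 2) ^ 2 / (1 / 2 * ‖k‖ ^ 4 / (‖k‖ ^ 2 + 1)) := by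
        gcongr
    _ = 2 * κ ^ 2 * (‖k‖ ^ 2 + 1) / ‖k‖ ^ 8 := by
        field_simp

/-- **Pointwise limit of the cut-off integrand** off the origin: along
`a → ∞, b → 0⁺, c → 1, d → ∞`, `(g + h) - √((g+h)² - g²) → |k|² + κ|k|⁻² - √(|k|⁴ + 2κ)`
(`g → κ|k|⁻²`, `h → |k|²`, `(κ|k|⁻² + |k|²)² - κ²|k|⁻⁴ = |k|⁴ + 2κ`). [cite: LiebSolovej2001, (6.19)] -/
theorem tendsto_foldyCutoffIntegrand (κ : ℝ) {k : Space} (hk : k ≠ 0) :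
    Tendsto (fun p : ℝ × ℝ × ℝ × ℝ =>
      (κ * (1 / (‖k‖ ^ 2 + p.1⁻¹ ^ 2) - 1 / (‖k‖ ^ 2 + p.2.1⁻¹ ^ 2)) +
          p.2.2.1 * ‖k‖ ^ 4 / (‖k‖ ^ 2 + p.2.2.2⁻¹ ^ 2)) -
        Real.sqrt ((κ * (1 / (‖k‖ ^ 2 + p.1⁻¹ ^ 2) - 1 / (‖k‖ ^ 2 + p.2.1⁻¹ ^ 2)) +
            p.2.2.1 * ‖k‖ ^ 4 / (‖k‖ ^ 2 + p.2.2.2⁻¹ ^ 2)) ^ 2 -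
          (κ * (1 / (‖k‖ ^ 2 + p.1⁻¹ ^ 2) - 1 / (‖k‖ ^ 2 + p.2.1⁻¹ ^ 2))) ^ 2))
      (atTop ×ˢ (𝓝[>] 0 ×ˢ (𝓝 1 ×ˢ atTop)))
      (𝓝 (‖k‖ ^ 2 + κ * (‖k‖ ^ 2)⁻¹ - Real.sqrt (‖k‖ ^ 4 + 2 * κ))) := by
  have hk0 : 0 < ‖k‖ := norm_pos_iff.2 hk
  have hk2 : (‖k‖ ^ 2) ≠ 0 := by positivity
  set 𝓕 : Filter (ℝ × ℝ × ℝ × ℝ) := atTop ×ˢ (𝓝[>] 0 ×ˢ (𝓝 1 ×ˢ atTop)) with h𝓕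
  -- the four coordinate limits
  have hA : Tendsto (fun p : ℝ × ℝ × ℝ × ℝ => p.1⁻¹ ^ 2) 𝓕 (𝓝 0) := by
    have h1 : Tendsto (fun p : ℝ × ℝ × ℝ × ℝ => p.1) 𝓕 atTop := tendsto_fst
    have h2 := tendsto_inv_atTop_zero.comp h1
    simpa using h2.pow 2
  have hB : Tendsto (fun p : ℝ × ℝ × ℝ × ℝ => 1 / (‖k‖ ^ 2 + p.2.1⁻¹ ^ 2)) 𝓕 (𝓝 0) := by
    have h1 : Tendsto (fun p : ℝ × ℝ × ℝ × ℝ => p.2.1) 𝓕 (𝓝[>] 0) := tendsto_fst.comp tendsto_snd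
    have h2 : Tendsto (fun p : ℝ × ℝ × ℝ × ℝ => p.2.1⁻¹) 𝓕 atTop := tendsto_inv_nhdsGT_zero.comp h1
    have h3 : Tendsto (fun p : ℝ × ℝ × ℝ × ℝ => p.2.1⁻¹ ^ 2) 𝓕 atTop := (tendsto_pow_atTop two_ne_zero).comp h2
    have h4 : Tendsto (fun p : ℝ × ℝ × ℝ × ℝ => ‖k‖ ^ 2 + p.2.1⁻¹ ^ 2) 𝓕 atTop :=
      tendsto_atTop_add_const_left _ _ h3
    refine (tendsto_inv_atTop_zero.comp h4).congr fun p => ?_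
    simp only [Function.comp_apply, one_div]
  have hC : Tendsto (fun p : ℝ × ℝ × ℝ × ℝ => p.2.2.1) 𝓕 (𝓝 1) := tendsto_fst.comp (tendsto_snd.comp tendsto_snd)
  have hD : Tendsto (fun p : ℝ × ℝ × ℝ × ℝ => p.2.2.2⁻¹ ^ 2) 𝓕 (𝓝 0) := by
    have h1 : Tendsto (fun p : ℝ × ℝ × ℝ × ℝ => p.2.2.2) 𝓕 atTop := tendsto_snd.comp (tendsto_snd.comp tendsto_snd)
    have h2 := tendsto_inv_atTop_zero.comp h1
    simpa using h2.pow 2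
  -- `g → κ/|k|²`, `h → |k|²`
  have hg : Tendsto (fun p : ℝ × ℝ × ℝ × ℝ =>
      κ * (1 / (‖k‖ ^ 2 + p.1⁻¹ ^ 2) - 1 / (‖k‖ ^ 2 + p.2.1⁻¹ ^ 2))) 𝓕 (𝓝 (κ * (‖k‖ ^ 2)⁻¹)) := by
    have h0 : Tendsto (fun p : ℝ × ℝ × ℝ × ℝ => ‖k‖ ^ 2 + p.1⁻¹ ^ 2) 𝓕 (𝓝 (‖k‖ ^ 2)) := by
      simpa using (tendsto_const_nhds (x := ‖k‖ ^ 2)).add hA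
    have h1 : Tendsto (fun p : ℝ × ℝ × ℝ × ℝ => 1 / (‖k‖ ^ 2 + p.1⁻¹ ^ 2)) 𝓕 (𝓝 (1 / ‖k‖ ^ 2)) :=
      (tendsto_const_nhds (x := (1 : ℝ))).div h0 hk2
    have h2 := (h1.sub hB).const_mul κ
    simpa [one_div] using h2
  have hh : Tendsto (fun p : ℝ × ℝ × ℝ × ℝ => p.2.2.1 * ‖k‖ ^ 4 / (‖k‖ ^ 2 + p.2.2.2⁻¹ ^ 2)) 𝓕 (𝓝 (‖k‖ ^ 2)) := by
    have h1 := ((hC.mul_const (‖k‖ ^ 4)).div ((tendsto_const_nhds (x := ‖k‖ ^ 2)).add hD)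
      (by positivity))
    have e : 1 * ‖k‖ ^ 4 / (‖k‖ ^ 2 + 0) = ‖k‖ ^ 2 := by
      rw [add_zero, one_mul]
      field_simp
    rw [e] at h1
    exact h1
  have hsum := hg.add hh
  have hsq := ((hsum.pow 2).sub (hg.pow 2)).sqrt
  have e2 : (κ * (‖k‖ ^ 2)⁻¹ + ‖k‖ ^ 2) ^ 2 - (κ * (‖k‖ ^ 2)⁻¹) ^ 2 = ‖k‖ ^ 4 + 2 * κ := by
    field_simp
    ring
  rw [e2] at hsq
  have hfin := hsum.sub hsq
  have e3 : κ * (‖k‖ ^ 2)⁻¹ + ‖k‖ ^ 2 - Real.sqrt (‖k‖ ^ 4 + 2 * κ) =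
      ‖k‖ ^ 2 + κ * (‖k‖ ^ 2)⁻¹ - Real.sqrt (‖k‖ ^ 4 + 2 * κ) := by ring
  rw [e3] at hfin
  exact hfin

/-- **Removing the cutoffs** [LiebSolovej2001, after (6.19)]: for `κ ≥ 0`, as `a → ∞`, `b → 0⁺`,
`c → 1`, `d → ∞`,
`∫_{ℝ³} ((g + h) - √((g + h)² - g²)) dk → ∫_{ℝ³} (|k|² + κ|k|⁻² - √(|k|⁴ + 2κ)) dk`,
`g = κ(1/(|k|² + a⁻²) - 1/(|k|² + b⁻²))`, `h = c|k|⁴/(|k|² + d⁻²)` (dominated convergence with the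
dominator of `integrable_foldyDominator`). [cite: LiebSolovej2001, Cor. 6.5 and (6.19)] -/
theorem tendsto_integral_foldyCutoff {κ : ℝ} (hκ : 0 ≤ κ) :
    Tendsto (fun p : ℝ × ℝ × ℝ × ℝ => ∫ k : Space,
      ((κ * (1 / (‖k‖ ^ 2 + p.1⁻¹ ^ 2) - 1 / (‖k‖ ^ 2 + p.2.1⁻¹ ^ 2)) +
          p.2.2.1 * ‖k‖ ^ 4 / (‖k‖ ^ 2 + p.2.2.2⁻¹ ^ 2)) -
        Real.sqrt ((κ * (1 / (‖k‖ ^ 2 + p.1⁻¹ ^ 2) - 1 / (‖k‖ ^ 2 + p.2.1⁻¹ ^ 2)) +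
            p.2.2.1 * ‖k‖ ^ 4 / (‖k‖ ^ 2 + p.2.2.2⁻¹ ^ 2)) ^ 2 -
          (κ * (1 / (‖k‖ ^ 2 + p.1⁻¹ ^ 2) - 1 / (‖k‖ ^ 2 + p.2.1⁻¹ ^ 2))) ^ 2)))
      (atTop ×ˢ (𝓝[>] 0 ×ˢ (𝓝 1 ×ˢ atTop)))
      (𝓝 (∫ k : Space, (‖k‖ ^ 2 + κ * (‖k‖ ^ 2)⁻¹ - Real.sqrt (‖k‖ ^ 4 + 2 * κ)))) := by
  set 𝓕 : Filter (ℝ × ℝ × ℝ × ℝ) := atTop ×ˢ (𝓝[>] 0 ×ˢ (𝓝 1 ×ˢ atTop)) with h𝓕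
  -- the good parameter region, eventually
  have hreg : ∀ᶠ p : ℝ × ℝ × ℝ × ℝ in 𝓕,
      1 ≤ p.1 ∧ (0 < p.2.1 ∧ p.2.1 ≤ 1) ∧ (1 / 2 ≤ p.2.2.1) ∧ 1 ≤ p.2.2.2 := by
    have h1 : ∀ᶠ a : ℝ in atTop, 1 ≤ a := eventually_ge_atTop 1
    have h2 : ∀ᶠ b : ℝ in 𝓝[>] 0, 0 < b ∧ b ≤ 1 := by
      have hb1 : ∀ᶠ b : ℝ in 𝓝[>] 0, b ∈ Ioo (0 : ℝ) 1 := Ioo_mem_nhdsGT zero_lt_one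
      filter_upwards [hb1] with b hb using ⟨hb.1, hb.2.le⟩
    have h3 : ∀ᶠ c : ℝ in 𝓝 1, 1 / 2 ≤ c := eventually_ge_nhds (by norm_num)
    have h4 : ∀ᶠ d : ℝ in atTop, 1 ≤ d := eventually_ge_atTop 1
    exact h1.prod_mk (h2.prod_mk (h3.prod_mk h4))
  have hae : ∀ᵐ k : Space ∂volume, k ≠ 0 := by
    have : (volume : Measure Space) {k | ¬k ≠ 0} = 0 := by
      simp only [ne_eq, not_not, setOf_eq_eq_singleton, measure_singleton]
    exact ae_iff.2 this
  refine tendsto_integral_filter_of_dominated_convergence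
    (fun k : Space => min (κ / ‖k‖ ^ 2) (2 * κ ^ 2 * (‖k‖ ^ 2 + 1) / ‖k‖ ^ 8)) ?_ ?_
    (integrable_foldyDominator hκ) ?_
  · -- measurability in `k`
    exact Eventually.of_forall fun p => Measurable.aestronglyMeasurable (by fun_prop)
  · -- domination on the good region
    filter_upwards [hreg] with p hp
    filter_upwards [hae] with k hk
    obtain ⟨h0, h1⟩ := foldyCutoffIntegrand_bounds hκ hp.1 hp.2.1.1 hp.2.1.2 hp.2.2.1 hp.2.2.2 hk
    exact (Real.norm_of_nonneg h0).trans_le h1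
  · -- pointwise convergence off the origin
    filter_upwards [hae] with k hk
    exact tendsto_foldyCutoffIntegrand κ hk

/-- **The cut-off Bogoliubov energy tends to Foldy's**: for `q, ρ > 0` and `κ = 4πqρ`, along
`a → ∞, b → 0⁺, c → 1, d → ∞`, `½(2π)⁻³ ∫_{ℝ³} F_{a,b,c,d} → foldyConstant · q^{5/4} ρ^{5/4}`
(`tendsto_integral_foldyCutoff` and `bogoliubov_momentum_integral`).
[cite: LiebSolovej2001, (6.19); LSSY2005, Thm. 10.1 (10.2)] -/
theorem tendsto_foldyCutoff_energy {q ρ : ℝ} (hq : 0 < q) (hρ : 0 < ρ) :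
    Tendsto (fun p : ℝ × ℝ × ℝ × ℝ => 1 / 2 * ((2 * π) ^ 3)⁻¹ * ∫ k : Space,
      (((4 * π * q * ρ) * (1 / (‖k‖ ^ 2 + p.1⁻¹ ^ 2) - 1 / (‖k‖ ^ 2 + p.2.1⁻¹ ^ 2)) +
          p.2.2.1 * ‖k‖ ^ 4 / (‖k‖ ^ 2 + p.2.2.2⁻¹ ^ 2)) -
        Real.sqrt (((4 * π * q * ρ) * (1 / (‖k‖ ^ 2 + p.1⁻¹ ^ 2) - 1 / (‖k‖ ^ 2 + p.2.1⁻¹ ^ 2)) +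
            p.2.2.1 * ‖k‖ ^ 4 / (‖k‖ ^ 2 + p.2.2.2⁻¹ ^ 2)) ^ 2 -
          ((4 * π * q * ρ) * (1 / (‖k‖ ^ 2 + p.1⁻¹ ^ 2) - 1 / (‖k‖ ^ 2 + p.2.1⁻¹ ^ 2))) ^ 2)))
      (atTop ×ˢ (𝓝[>] 0 ×ˢ (𝓝 1 ×ˢ atTop)))
      (𝓝 (foldyConstant * q ^ (5 / 4 : ℝ) * ρ ^ (5 / 4 : ℝ))) := by
  have hκ : 0 ≤ 4 * π * q * ρ := by positivity
  have h := (tendsto_integral_foldyCutoff hκ).const_mul (1 / 2 * ((2 * π) ^ 3)⁻¹)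
  have e : 1 / 2 * ((2 * π) ^ 3)⁻¹ *
      ∫ k : Space, (‖k‖ ^ 2 + 4 * π * q * ρ * (‖k‖ ^ 2)⁻¹ - Real.sqrt (‖k‖ ^ 4 + 2 * (4 * π * q * ρ))) =
      foldyConstant * q ^ (5 / 4 : ℝ) * ρ ^ (5 / 4 : ℝ) := by
    rw [← bogoliubov_momentum_integral hq hρ, show 2 * (4 * π * q * ρ) = 8 * π * q * ρ by ring]
  rw [e] at h
  exact h

end Literature.MathematicalPhysics.QuantumManyBody.JelliumBoseGas
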